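import Mathlib
import HarnessLib
import Literature.Analysis.FluidPDE.HydrodynamicImpulseBalanceEnergy
import Literature.Analysis.FluidPDE.HydrodynamicImpulseBalanceEnergyVector
import Literature.Analysis.FluidPDE.HydrodynamicImpulseRigidity
import Summits.NavierStokesRegularity.NavierStokesRegularity.Theorems.HeredityAtOne.Negative.StageImpulseLedger

/-!
# The capped signed swirl-free stratum is EMPTY on every design of non-positive total axial push —
# UNCONDITIONALLY (Saffman (3.2.9) from the energy alone, on the register)

Cell `ns-blowup`, seat `ns-blowup-fc-prover-3` (g8; prover, GROUP E re-point; bears_on LADDER-NS N1, route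
`PalasekTowerBreakdown`, crux `HeredityAtOne` = item stmt-NavierStokesRegularity-19249, NEGATIVE LANE — supports
only). LABEL: KERNEL bookkeeping (theorems only; no definition, no named fact; nothing asserted about the crux).

Sequel of `StageImpulseLedger.lean` (the vector impulse ledger of a registered stage under the first-moment
vorticity-decay hypothesis D). Here the decay hypothesis is GONE: the axial impulse balance holds for every
classical finite-energy forced flow (`Literature/Analysis/FluidPDE/HydrodynamicImpulseBalanceEnergy.lean`, this
seat: the momentum equation tested against `curl (χ_R J)`, only the energy enters), and every registered stage
`s : Stage ν R S m k` (ANY viscosity, rates, schedule, margins, level) is such a flow — classical on `[0, τ_k]`,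
finite energy (`s.energy`), Clay force (`S.force_decay`), Clay datum (`S.datum_decay`). Hence:

* `integral_swirl_curl_slice_eq_two_mul_force` — for every registered stage and every readout `j ≤ k` whose
  `τ_j`-slice has an integrable axial impulse density `(x × ω)₃ = swirl ω`:
  `∫ swirl ω(τ_j) dx = 2 ∫₀^{τ_j} ∫ (S.f)₃ dx dt` (the Clay datum opens the ledger at zero);
  `integrable_swirl_curl_slice_of_nonneg` — a single-signed `τ_j`-slice (`swirl ω(τ_j) ≥ 0`) is automatically in
  the scope (Fatou), with the same identity;
* `integral_force_axial_pos_of_signedNoSwirlSlice` — **every registered stage whose `τ_j`-slice is a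
  single-signed swirl-free field was pushed with POSITIVE total axial mean, `0 < ∫₀^{τ_j} ∫ (S.f)₃`**
  (the slice carries `½∫ r²(ω_θ/r) > 0`, g7's `integral_cylRadius_sq_mul_angVortQuot_pos_of_signedNoSwirlSlice`);
* `not_inCapStratum_of_integral_force_axial_nonpos`, `capStratumEmptyAt_on_nonposMean`,
  `not_inCapStratum_of_zeroMean` — **`CapStratumEmptyAt k` HOLDS on every design whose force has non-positive
  total axial mean on `[0, τ_k]`** (in particular every design pushing with ZERO spatial mean at each time, e.g.
  `curl`-type forces), for every `k`, with NO further hypothesis;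
* `heredityAtOne_iff_offStratum_and_empty_posMean` — **item 19249's split, sharpened by name and losslessly**:
  `HeredityAtOne ↔ HeredityAtOffStratum 1 ∧ (𝒮₁ has no stage of a design with 0 < ∫₀^{τ₁}∫(S.f)₃)`;
  `heredityAtOffStratum_one_covers_nonposMean`, `exists_posMean_stratum_stage_of_not_heredityAtOne` — given `C′`,
  any counterexample to item 19249 is a design of POSITIVE total axial push on `[0, τ₁]`.

READING FOR THE ROUTE: the stratum lane (K5-15/KJ-16 signed-slice door, disprove-1's split) can only be fed by
designs injecting positive axial momentum before `τ₁`; designs with mean-zero pushes are decided by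
`C′ = HeredityAtOffStratum 1` alone. Nothing here moves the crux — 19179 remains the bottleneck.
WHAT THIS IS NOT: not Navier–Stokes evidence and no verdict change on item 19249; no stage, slice, flow or design
is constructed.

References: P. G. Saffman, *Vortex Dynamics* (1992) §3.2 (3.2.8)–(3.2.9) [cite: Saffman1992, §3.2];
Th. Gallay, V. Šverák, Confluentes Math. 7 (2015) Lemma 6.4 [cite: GallaySverak2016, Lemma 6.4];
S. Palasek, arXiv:2605.13827 §3.3–§4 [cite: Palasek2026ElementaryModel, §4].
-/

noncomputable section

namespace Summit.NavierStokesRegularity.HeredityAtOneImpulseEnergy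

open Set MeasureTheory Filter Function InnerProductSpace
open scoped RealInnerProductSpace ContDiff Topology ENNReal
open Literature.Analysis.FluidPDE
open Summit.NavierStokesRegularity.FluidComputer
open Summit.NavierStokesRegularity.FluidComputer.PalasekTowerClayBridge
open Summit.NavierStokesRegularity.NavierStokesRegularity
open Summit.NavierStokesRegularity.HeredityAtOneNoSwirlCap
open Summit.NavierStokesRegularity.HeredityAtOneNoSwirlStratum
open Summit.NavierStokesRegularity.HeredityAtOneImpulse
open Summit.NavierStokesRegularity.HeredityAtOneImpulseBalance

/-! ## §1 The register supplies the energy law's inputs -/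

section Register

variable {ν : ℝ} {R : TowerRates} {S : Schedule R} {m : Margins R} {k : ℕ}

/-- **A uniform energy level of a registered stage**: `∫ ‖u(t)‖² ≤ E` on `[0, τ_k]` (the stage's energy clause,
in real form). [cite: Palasek2026ElementaryModel, §3.3] -/
theorem exists_energy_level (s : Stage ν R S m k) :
    ∃ E : ℝ, ∀ t ∈ Icc 0 (S.τ k), ∫ x, ‖s.u t x‖ ^ 2 ≤ E := by
  obtain ⟨C, hCt, hC⟩ := s.energy
  refine ⟨C.toReal, fun t ht => ?_⟩
  have h2 : ∫ x, ‖s.u t x‖ ^ 2 = (∫⁻ x, ‖s.u t x‖ₑ ^ 2).toReal := by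
    rw [integral_eq_lintegral_of_nonneg_ae (Eventually.of_forall fun x => sq_nonneg _)
      (integrable_norm_sq_slice s ht).aestronglyMeasurable]
    congr 1
    refine lintegral_congr fun x => ?_
    rw [ENNReal.ofReal_pow (norm_nonneg _), ofReal_norm]
  rw [h2]
  exact ENNReal.toReal_mono hCt.ne (hC t ht)

/-- **An integrable majorant of the force slices on the slab** (Fefferman (5): `‖S.f t x‖ ≤ C₀ (1+|x|)⁻⁴`).
[cite: Tao2011, Def. 1.1 (p. 3)] -/
theorem exists_force_majorant (S : Schedule R) (k : ℕ) :
    ∃ F : EuclideanSpace ℝ (Fin 3) → ℝ, Integrable F ∧ ∀ t ∈ Icc 0 (S.τ k), ∀ x, ‖S.f t x‖ ≤ F x := by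
  obtain ⟨C₀, -, hF0⟩ := force_slice_bound S k 0 4
  refine ⟨fun x => C₀ * (1 + ‖x‖) ^ (-(4 : ℝ)), integrable_one_add_norm_neg_four.const_mul C₀,
    fun t ht x => ?_⟩
  have h := hF0 t ht x
  rw [norm_iteratedFDeriv_zero] at h
  have hw : 0 < 1 + ‖x‖ := by positivity
  show ‖S.f t x‖ ≤ C₀ * (1 + ‖x‖) ^ (-(4 : ℝ))
  rw [show (-(4 : ℝ)) = -((4 : ℕ) : ℝ) by norm_num, Real.rpow_neg hw.le, Real.rpow_natCast,
    ← div_eq_mul_inv, le_div_iff₀ (by positivity)]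
  linarith [mul_comm ((1 + ‖x‖) ^ 4) ‖S.f t x‖]

/-- `|swirl w x| ≤ ‖x‖ ‖w x‖` (`swirl w x = (x × w(x))₃`). [folklore] -/
theorem abs_swirl_le (w : EuclideanSpace ℝ (Fin 3) → EuclideanSpace ℝ (Fin 3)) (x : EuclideanSpace ℝ (Fin 3)) :
    |swirl w x| ≤ ‖x‖ * ‖w x‖ := by
  have e : swirl w x = cross x (w x) 2 := by simp [cross, cross_apply, swirl]
  rw [e]
  have h1 : |cross x (w x) 2| ≤ ‖cross x (w x)‖ := by simpa using PiLp.norm_apply_le (cross x (w x)) 2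
  exact h1.trans (norm_cross_le_norm_mul_norm _ _)

/-- **The datum's axial impulse density is integrable** (Clay datum: `(1+|x|)⁵ ‖Du₀‖ ≤ C`, so
`|swirl (curl u₀)| ≤ |x| ‖curl u₀‖ ≤ ‖curlCLM‖ C (1+|x|)⁻⁴`). [folklore] -/
theorem integrable_swirl_curl_datum (s : Stage ν R S m k) : Integrable fun x => swirl (curl (s.u 0)) x := by
  have h0 : (0 : ℝ) ∈ Icc 0 (S.τ k) := ⟨le_rfl, (S.τ_pos k).le⟩
  have hu1 : ContDiff ℝ 1 (s.u 0) := (s.contDiff_slice h0).of_le (by norm_cast)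
  obtain ⟨C, hC⟩ := s.hasRapidSpatialDecay_zero 1 5
  have hcont : Continuous fun x => swirl (curl (s.u 0)) x := by
    have hc : Continuous (curl (s.u 0)) := continuous_curl hu1
    unfold swirl
    fun_prop
  refine (integrable_one_add_norm_neg_four.const_mul (‖curlCLM‖ * C)).mono' hcont.aestronglyMeasurable
    (Eventually.of_forall fun x => ?_)
  have h := hC x
  rw [← norm_iteratedFDeriv_fderiv (n := 0), norm_iteratedFDeriv_zero] at h
  have hw : 0 < 1 + ‖x‖ := by positivity
  rw [Real.norm_eq_abs]
  calc |swirl (curl (s.u 0)) x| ≤ ‖x‖ * ‖curl (s.u 0) x‖ := abs_swirl_le _ _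
    _ ≤ (1 + ‖x‖) * (‖curlCLM‖ * ‖fderiv ℝ (s.u 0) x‖) := by
        gcongr
        · linarith [norm_nonneg x]
        · exact norm_curl_le_opNorm_mul _ _
    _ = ‖curlCLM‖ * ((1 + ‖x‖) * ‖fderiv ℝ (s.u 0) x‖) := by ring
    _ ≤ ‖curlCLM‖ * (C * (1 + ‖x‖) ^ (-(4 : ℝ))) := by
        refine mul_le_mul_of_nonneg_left ?_ (norm_nonneg curlCLM)
        rw [show (-(4 : ℝ)) = -((4 : ℕ) : ℝ) by norm_num, Real.rpow_neg hw.le, Real.rpow_natCast,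
          ← div_eq_mul_inv, le_div_iff₀ (by positivity)]
        calc (1 + ‖x‖) * ‖fderiv ℝ (s.u 0) x‖ * (1 + ‖x‖) ^ 4
            = (1 + ‖x‖) ^ 5 * ‖fderiv ℝ (s.u 0) x‖ := by ring
          _ ≤ C := h
    _ = ‖curlCLM‖ * C * (1 + ‖x‖) ^ (-(4 : ℝ)) := by ring

/-- **The datum's axial impulse vanishes**: `∫ swirl (curl S.u₀) = 0` (Clay datum: `C¹`, divergence free,
integrable; Saffman (3.2.13)/(3.2.15)). [cite: Saffman1992, §3.2 eqs. (3.2.13), (3.2.15)] -/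
theorem integral_swirl_curl_datum (s : Stage ν R S m k) : ∫ x, swirl (curl (s.u 0)) x = 0 := by
  have h0 : (0 : ℝ) ∈ Icc 0 (S.τ k) := ⟨le_rfl, (S.τ_pos k).le⟩
  have hu1 : ContDiff ℝ 1 (s.u 0) := (s.contDiff_slice h0).of_le (by norm_cast)
  exact integral_swirl_curl_eq_zero_of_isDivFree hu1 (s.classical.divFree 0 h0)
    (s.hasRapidSpatialDecay_zero.integrable hu1.continuous) (integrable_swirl_curl_datum s)

/-! ## §2 The axial impulse ledger of a registered stage — no decay hypothesis -/

/-- **THE AXIAL IMPULSE LEDGER OF A REGISTERED STAGE (unconditional).** For every stage `s : Stage ν R S m k`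
(any viscosity, rates, schedule, margins, level) and every readout `j ≤ k` whose `τ_j`-slice has an integrable
axial impulse density `swirl ω = (x × ω)₃`:
`∫ swirl ω(τ_j, x) dx = 2 ∫₀^{τ_j} ∫ (S.f t x)₃ dx dt` — twice the total axial push. (The Clay datum opens the
ledger at zero; only the energy of the stage enters the proof.) [cite: Saffman1992, §3.2 eqs. (3.2.8), (3.2.9)] -/
theorem integral_swirl_curl_slice_eq_two_mul_force (s : Stage ν R S m k) {j : ℕ} (hj : j ≤ k)
    (hI : Integrable fun x => swirl (curl (s.u (S.τ j))) x) :
    ∫ x, swirl (curl (s.u (S.τ j))) x = 2 * ∫ t in (0 : ℝ)..S.τ j, ∫ x, S.f t x 2 := by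
  obtain ⟨E, hE⟩ := exists_energy_level s
  obtain ⟨F, hF, hfF⟩ := exists_force_majorant S k
  have hlaw := s.classical.integral_swirl_vorticity_sub_eq_of_energy (S.τ_pos k)
    (fun t ht => integrable_norm_sq_slice s ht) hE hF hfF le_rfl (S.τ_pos j).le (S.τ_mono hj)
    (integrable_swirl_curl_datum s) hI
  rw [integral_swirl_curl_datum s, sub_zero] at hlaw
  exact hlaw

/-- **Fatou form: a single-signed readout slice is automatically in scope.** If the `τ_j`-slice of a registered
stage has `swirl ω(τ_j) ≥ 0` everywhere (a single-signed axial impulse density — every signed swirl-free slice,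
every vortex ring), then `swirl ω(τ_j) ∈ L¹` and `∫ swirl ω(τ_j) = 2 ∫₀^{τ_j} ∫ (S.f)₃`.
[cite: Saffman1992, §3.2 eq. (3.2.9)] [cite: GallaySverak2016, Lemma 6.4 (arXiv p. 19)] -/
theorem integrable_swirl_curl_slice_of_nonneg (s : Stage ν R S m k) {j : ℕ} (hj : j ≤ k)
    (hnn : ∀ x, 0 ≤ swirl (curl (s.u (S.τ j))) x) :
    Integrable (fun x => swirl (curl (s.u (S.τ j))) x) ∧
      ∫ x, swirl (curl (s.u (S.τ j))) x = 2 * ∫ t in (0 : ℝ)..S.τ j, ∫ x, S.f t x 2 := by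
  obtain ⟨E, hE⟩ := exists_energy_level s
  obtain ⟨F, hF, hfF⟩ := exists_force_majorant S k
  have h := s.classical.integrable_swirl_vorticity_of_nonneg (S.τ_pos k)
    (fun t ht => integrable_norm_sq_slice s ht) hE hF hfF le_rfl (S.τ_pos j).le (S.τ_mono hj)
    (integrable_swirl_curl_datum s) hnn
  rw [integral_swirl_curl_datum s, zero_add] at h
  exact h

/-- **Axisymmetric swirl-free form**: if the `τ_j`-slice is axisymmetric with `r²·(ω_θ/r) ∈ L¹`, then
`∫ r² (ω_θ/r)(τ_j) dx = 2 ∫₀^{τ_j} ∫ (S.f)₃` — Saffman's `I₃ = ½∫ r²(ω_θ/r)` equals the total axial push.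
[cite: Saffman1992, §3.2 eqs. (3.2.8), (3.2.9)] -/
theorem integral_cylRadius_sq_mul_angVortQuot_slice_eq (s : Stage ν R S m k) {j : ℕ} (hj : j ≤ k)
    (hax : IsAxisymmetric (s.u (S.τ j)))
    (hI : Integrable fun x => cylRadius x ^ 2 * angVortQuot (s.u (S.τ j)) x) :
    ∫ x, cylRadius x ^ 2 * angVortQuot (s.u (S.τ j)) x = 2 * ∫ t in (0 : ℝ)..S.τ j, ∫ x, S.f t x 2 := by
  have hv3 : ContDiff ℝ 3 (s.u (S.τ j)) := (s.contDiff_slice (τ_mem_Icc S hj)).of_le (by norm_cast)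
  have hdict := hax.swirl_curl_eq_cylRadius_sq_mul_angVortQuot hv3
  have hI' : Integrable fun x => swirl (curl (s.u (S.τ j))) x := by rw [hdict]; exact hI
  have h := integral_swirl_curl_slice_eq_two_mul_force s hj hI'
  rwa [hdict] at h

/-! ## §3 Signed swirl-free readout slices were pushed with positive axial mean — unconditionally -/

/-- **A REGISTERED STAGE WHOSE `τ_j`-SLICE IS SIGNED SWIRL-FREE WAS PUSHED WITH POSITIVE TOTAL AXIAL MEAN.**
For every stage (any viscosity, rates, schedule, margins, level) and every `j ≤ k`: if the `τ_j`-slice is a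
single-signed swirl-free axisymmetric field (`SignedNoSwirlSlice`), then `0 < ∫₀^{τ_j} ∫ (S.f t x)₃ dx dt`.
No decay hypothesis: the slice's impulse `½∫r²(ω_θ/r) > 0` (g7) IS the total axial push (§2).
[cite: Saffman1992, §3.2 eqs. (3.2.8), (3.2.9)] [cite: Palasek2026ElementaryModel, §3.3] -/
theorem integral_force_axial_pos_of_signedNoSwirlSlice (s : Stage ν R S m k) {j : ℕ} (hj : j ≤ k) {M : ℝ}
    (hsl : SignedNoSwirlSlice (s.u (S.τ j)) M) : 0 < ∫ t in (0 : ℝ)..S.τ j, ∫ x, S.f t x 2 := by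
  have hpos := integral_cylRadius_sq_mul_angVortQuot_pos_of_signedNoSwirlSlice s hj hsl
  have hlaw := integral_cylRadius_sq_mul_angVortQuot_slice_eq s hj hsl.axisym hsl.integrable_sq
  linarith

/-- Contrapositive: a registered stage pushed with NON-POSITIVE total axial mean on `[0, τ_j]` has no signed
swirl-free `τ_j`-slice. [cite: Saffman1992, §3.2 eq. (3.2.9)] -/
theorem not_signedNoSwirlSlice_of_integral_force_axial_nonpos (s : Stage ν R S m k) {j : ℕ} (hj : j ≤ k)
    (hmean : ∫ t in (0 : ℝ)..S.τ j, ∫ x, S.f t x 2 ≤ 0) (M : ℝ) : ¬ SignedNoSwirlSlice (s.u (S.τ j)) M :=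
  fun hsl => absurd hmean (not_le.2 (integral_force_axial_pos_of_signedNoSwirlSlice s hj hsl))

/-- **Zero-mean pushes**: if `∫ S.f(t, x) dx = 0` for every `t ∈ [0, τ_j]` (e.g. a `curl`-type force), no
registered stage of the design has a signed swirl-free `τ_j`-slice. [cite: Saffman1992, §3.2 eq. (3.2.9)] -/
theorem not_signedNoSwirlSlice_of_zeroMean (s : Stage ν R S m k) {j : ℕ} (hj : j ≤ k)
    (hzero : ∀ t ∈ Icc 0 (S.τ j), ∫ x, S.f t x = 0) (M : ℝ) : ¬ SignedNoSwirlSlice (s.u (S.τ j)) M := by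
  refine not_signedNoSwirlSlice_of_integral_force_axial_nonpos s hj (le_of_eq ?_) M
  rw [intervalIntegral.integral_of_le (S.τ_pos j).le]
  refine setIntegral_eq_zero_of_forall_eq_zero fun t ht => ?_
  have ht' : t ∈ Icc 0 (S.τ j) := Ioc_subset_Icc_self ht
  have hsub : Icc 0 (S.τ j) ⊆ Icc 0 (S.τ k) := Icc_subset_Icc le_rfl (S.τ_mono hj)
  obtain ⟨F, hF, hfF⟩ := exists_force_majorant S k
  have hfc : Continuous (S.f t) := ((isSmoothSpaceTimeOn_force_slab S k).contDiff_slice (hsub ht')).continuous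
  have hfi : Integrable (S.f t) :=
    hF.mono' hfc.aestronglyMeasurable (Eventually.of_forall (hfF t (hsub ht')))
  have e : (∫ x, S.f t x) 2 = 0 := by rw [hzero t ht']; simp
  rw [integral_apply_fin_three hfi] at e
  exact e

end Register

/-! ## §4 The stratum `𝒮_k` of item 19249's split is empty on non-positive-mean designs — unconditionally -/

section Stratum

/-- **MEMBERS OF THE STRATUM WERE PUSHED WITH POSITIVE AXIAL MEAN** (route binder; no further hypothesis):
`InCapStratum k S s → 0 < ∫₀^{τ_k} ∫ (S.f)₃ dx dt` — the design column for any signed-vortex-ring host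
(K5-15/KJ-16 door). [cite: Saffman1992, §3.2 eq. (3.2.9)] [cite: Palasek2026ElementaryModel, §4] -/
theorem integral_force_axial_pos_of_inCapStratum {k : ℕ} {S : Schedule TowerRates.wide}
    {s : Stage 1 TowerRates.wide S (Margins.routeG TowerRates.wide) k} (hs : InCapStratum k S s) :
    0 < ∫ t in (0 : ℝ)..S.τ k, ∫ x, S.f t x 2 := by
  obtain ⟨M, hsl, _⟩ := hs
  exact integral_force_axial_pos_of_signedNoSwirlSlice s le_rfl hsl

/-- **NO DESIGN OF NON-POSITIVE TOTAL AXIAL PUSH HAS A STAGE IN `𝒮_k`** (no pins / rigidity / quietness / cap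
inequality / decay used). [cite: Saffman1992, §3.2 eq. (3.2.9)] [cite: Palasek2026ElementaryModel, §4] -/
theorem not_inCapStratum_of_integral_force_axial_nonpos {k : ℕ} {S : Schedule TowerRates.wide}
    (s : Stage 1 TowerRates.wide S (Margins.routeG TowerRates.wide) k)
    (hmean : ∫ t in (0 : ℝ)..S.τ k, ∫ x, S.f t x 2 ≤ 0) : ¬ InCapStratum k S s :=
  fun hs => absurd hmean (not_le.2 (integral_force_axial_pos_of_inCapStratum hs))

/-- **`CapStratumEmptyAt k` ON THE NON-POSITIVE-MEAN SUB-REGISTER, UNCONDITIONALLY** (every `k`; the binder of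
`CapStratumEmptyAt` with the single design guard `∫₀^{τ_k}∫ (S.f)₃ ≤ 0`): the emptiness conjunct of item 19249's
lossless split holds there. What remains open of `CapStratumEmptyAt 1` concerns designs of POSITIVE total axial
push only. [cite: Saffman1992, §3.2 eq. (3.2.9)] [cite: Palasek2026ElementaryModel, §4] -/
theorem capStratumEmptyAt_on_nonposMean (k : ℕ) :
    ∀ S : Schedule TowerRates.wide, S.Pins 8 (6 / 5) → S.Rigid → S.Quiet →
      ∀ s : Stage 1 TowerRates.wide S (Margins.routeG TowerRates.wide) k,
        ∫ t in (0 : ℝ)..S.τ k, ∫ x, S.f t x 2 ≤ 0 → ¬ InCapStratum k S s :=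
  fun _ _ _ _ s hmean => not_inCapStratum_of_integral_force_axial_nonpos s hmean

/-- **ZERO-MEAN DESIGNS NEVER POPULATE THE STRATUM**: if the design's force has zero spatial mean at every time of
`[0, τ_k]` (e.g. a `curl`-type push `f = curl A` with decaying `A`), none of its registered level-`k` stages lies
in `𝒮_k`. [cite: Saffman1992, §3.2 eq. (3.2.9)] [cite: Palasek2026ElementaryModel, §4] -/
theorem not_inCapStratum_of_zeroMean {k : ℕ} {S : Schedule TowerRates.wide}
    (s : Stage 1 TowerRates.wide S (Margins.routeG TowerRates.wide) k)
    (hzero : ∀ t ∈ Icc 0 (S.τ k), ∫ x, S.f t x = 0) : ¬ InCapStratum k S s :=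
  fun ⟨M, hsl, _⟩ => not_signedNoSwirlSlice_of_zeroMean s le_rfl hzero M hsl

/-- **ITEM 19249'S SPLIT, SHARPENED BY NAME AND LOSSLESSLY**: the emptiness conjunct of
`heredityAtOne_iff_offStratum_and_empty` may be restricted to designs of POSITIVE total axial push on `[0, τ₁]`
— all other designs are off the stratum unconditionally:
`HeredityAtOne ↔ HeredityAtOffStratum 1 ∧ (no pinned rigid quiet wide design with 0 < ∫₀^{τ₁}∫(S.f)₃ has a
registered level-1 stage in 𝒮₁)`. [cite: Saffman1992, §3.2 eq. (3.2.9)] [cite: Palasek2026ElementaryModel, §4] -/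
theorem heredityAtOne_iff_offStratum_and_empty_posMean :
    Theses.PalasekTowerBreakdown.HeredityAtOne ↔
      HeredityAtOffStratum 1 ∧
        ∀ S : Schedule TowerRates.wide, S.Pins 8 (6 / 5) → S.Rigid → S.Quiet →
          ∀ s : Stage 1 TowerRates.wide S (Margins.routeG TowerRates.wide) 1,
            0 < ∫ t in (0 : ℝ)..S.τ 1, ∫ x, S.f t x 2 → ¬ InCapStratum 1 S s := by
  rw [heredityAtOne_iff_offStratum_and_empty]
  refine ⟨fun h => ⟨h.1, fun S hP hR hQ s _ => h.2 S hP hR hQ s⟩, fun h => ⟨h.1, fun S hP hR hQ s => ?_⟩⟩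
  by_cases hmean : 0 < ∫ t in (0 : ℝ)..S.τ 1, ∫ x, S.f t x 2
  · exact h.2 S hP hR hQ s hmean
  · exact not_inCapStratum_of_integral_force_axial_nonpos s (not_lt.1 hmean)

/-- **By name: the repaired statement `C′ = HeredityAtOffStratum 1` already decides every registered level-1
stage of a non-positive-mean design** — such a stage is off the stratum, so `C′` hands it a level-2 extension.
[cite: Palasek2026ElementaryModel, §4] -/
theorem heredityAtOffStratum_one_covers_nonposMean (h : HeredityAtOffStratum 1) {S : Schedule TowerRates.wide}
    (hP : S.Pins 8 (6 / 5)) (hR : S.Rigid) (hQ : S.Quiet)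
    (s : Stage 1 TowerRates.wide S (Margins.routeG TowerRates.wide) 1)
    (hmean : ∫ t in (0 : ℝ)..S.τ 1, ∫ x, S.f t x 2 ≤ 0) :
    ∃ s' : Stage 1 TowerRates.wide S (Margins.routeG TowerRates.wide) 2, s.Extends s' :=
  h S hP hR hQ s (not_inCapStratum_of_integral_force_axial_nonpos s hmean)

/-- **For the crux, by name**: given `C′ = HeredityAtOffStratum 1`, any counterexample to item 19249
(`Theses.PalasekTowerBreakdown.HeredityAtOne`) is a pinned rigid quiet wide design with a registered level-1
stage in `𝒮₁` whose force has POSITIVE total axial mean on `[0, τ₁]` — the impulse its signed level-1 slice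
carries had to be injected by the push. [cite: Saffman1992, §3.2 eq. (3.2.9)] [cite: Palasek2026ElementaryModel, §4] -/
theorem exists_posMean_stratum_stage_of_not_heredityAtOne (hC : HeredityAtOffStratum 1)
    (hno : ¬ Theses.PalasekTowerBreakdown.HeredityAtOne) :
    ∃ (S : Schedule TowerRates.wide) (s : Stage 1 TowerRates.wide S (Margins.routeG TowerRates.wide) 1),
      S.Pins 8 (6 / 5) ∧ S.Rigid ∧ S.Quiet ∧ InCapStratum 1 S s ∧
        0 < ∫ t in (0 : ℝ)..S.τ 1, ∫ x, S.f t x 2 := by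
  by_contra hne
  push Not at hne
  refine hno (heredityAtOne_iff_offStratum_and_empty_posMean.2 ⟨hC, fun S hP hR hQ s hpos hs => ?_⟩)
  exact absurd (hne S s hP hR hQ hs) (not_le.2 hpos)

end Stratum

/-! ## §5 (v2 append) The full VECTOR impulse ledger of a registered stage — unconditionally -/

section VectorLedger

variable {ν : ℝ} {R : TowerRates} {S : Schedule R} {m : Margins R} {k : ℕ}

/-- **THE VECTOR IMPULSE LEDGER OF A REGISTERED STAGE (unconditional; supersedes the D-conditional
`StageImpulseLedger.integral_cross_curl_slice_eq_two_smul`).** For every stage `s : Stage ν R S m k` (any viscosity,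
rates, schedule, margins, level) and every readout `j ≤ k` whose `τ_j`-slice has an integrable impulse density
`x × ω(τ_j)`: `∫ x × ω(τ_j, x) dx = 2 ∫₀^{τ_j} ∫ S.f(t, x) dx dt` — the hydrodynamic impulse `I = ½∫ x × ω` of the
readout slice IS the total push of the design up to `τ_j` (the Clay datum has zero impulse,
`integral_cross_curl_eq_zero_of_hasRapidSpatialDecay`; only the energy of the stage enters,
`IsClassicalNSSolutionOn.integral_cross_vorticity_sub_eq_of_energy`). [cite: Saffman1992, §3.2 eqs. (3.2.8), (3.2.9)] -/
theorem integral_cross_curl_slice_eq_two_smul_force (s : Stage ν R S m k) {j : ℕ} (hj : j ≤ k)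
    (hI : Integrable fun x => cross x (curl (s.u (S.τ j)) x)) :
    ∫ x, cross x (curl (s.u (S.τ j)) x) = (2 : ℝ) • ∫ t in (0 : ℝ)..S.τ j, ∫ x, S.f t x := by
  obtain ⟨E, hE⟩ := exists_energy_level s
  obtain ⟨F, hF, hfF⟩ := exists_force_majorant S k
  have h0 : (0 : ℝ) ∈ Icc 0 (S.τ k) := ⟨le_rfl, (S.τ_pos k).le⟩
  have hu1 : ContDiff ℝ 1 (s.u 0) := (s.contDiff_slice h0).of_le (by norm_cast)
  have hI0 : Integrable fun x => cross x (curl (s.u 0) x) :=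
    integrable_cross_curl_of_hasRapidSpatialDecay hu1 s.hasRapidSpatialDecay_zero
  have hlaw := s.classical.integral_cross_vorticity_sub_eq_of_energy (S.τ_pos k)
    (fun t ht => integrable_norm_sq_slice s ht) hE hF hfF le_rfl (S.τ_pos j).le (S.τ_mono hj) hI0 hI
  rw [integral_cross_curl_eq_zero_of_hasRapidSpatialDecay hu1 (s.classical.divFree 0 h0)
    s.hasRapidSpatialDecay_zero, sub_zero] at hlaw
  exact hlaw

/-- **Zero total push ⇒ zero impulse at every readout**: a registered stage of a design whose force has zero
spatial mean at every time of `[0, τ_j]` has `∫ x × ω(τ_j) = 0` whenever that density is integrable — the readout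
slices of zero-mean designs carry NO hydrodynamic impulse (in any direction). [cite: Saffman1992, §3.2 eq. (3.2.9)] -/
theorem integral_cross_curl_slice_eq_zero_of_zeroMean (s : Stage ν R S m k) {j : ℕ} (hj : j ≤ k)
    (hI : Integrable fun x => cross x (curl (s.u (S.τ j)) x))
    (hzero : ∀ t ∈ Icc 0 (S.τ j), ∫ x, S.f t x = 0) : ∫ x, cross x (curl (s.u (S.τ j)) x) = 0 := by
  rw [integral_cross_curl_slice_eq_two_smul_force s hj hI, intervalIntegral.integral_of_le (S.τ_pos j).le,
    setIntegral_eq_zero_of_forall_eq_zero fun t ht => hzero t (Ioc_subset_Icc_self ht), smul_zero]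

end VectorLedger

end Summit.NavierStokesRegularity.HeredityAtOneImpulseEnergy

end
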